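import Literature.Geometry.Lorentzian.SenWittenOperator
import Mathlib.Algebra.QuadraticDiscriminant
import HarnessLib

/-!
# The dominant energy condition makes Witten's potential non-negative

First brick of the analytic engine of Witten's proof of the positive energy theorem in the
Pauli model (`SenWittenOperator.lean`): the zeroth-order term
`decDensity D F ψ = ¼ (R − |k|² + (tr k)²) ‖ψ‖² + ½ (div k − d tr k)(Y_ψ) = 4π (μ ‖ψ‖² + J(Y_ψ))`
of the Lichnerowicz–Witten identity is NON-NEGATIVE at every point under the dominant energy
condition `|J|_h ≤ μ` (`InitialDataSet.SatisfiesDominantEnergyCondition`), in any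
`h`-orthonormal frame `F`. This is the remark after (3.2) of Parker–Taubes 1982 ("the dominant
energy condition implies `ℛ ≥ 0`"), resp. Witten 1981, §3 after (34); it is what makes the
energy `∫ ‖𝒟ψ‖² = ∫ (Σ‖∇̂ᵢψ‖² + decDensity ψ)` coercive and the mass non-negative.

* `SenWitten.sum_inner_pauli_sq_le` — `Σⱼ ⟪ψ, σⱼψ⟫² ≤ ‖ψ‖⁴` (the current is dominated by the
  density; Cauchy–Schwarz with `‖(Σ aⱼσⱼ)u‖ = |a| ‖u‖`);
* `SenWitten.inner_current_self_le` — `h(Y_ψ, Y_ψ) ≤ ‖ψ‖⁴`;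
* `SenWitten.apply_current_sq_le` — `α(Y_ψ)² ≤ h⁻¹(α, α) ‖ψ‖⁴` for every covector `α`;
* `SenWitten.decDensity_nonneg` — **`0 ≤ decDensity D F ψ x` under the dominant energy
  condition**.

All proved; no definitions, no named facts.

## References

* E. Witten, *A new proof of the positive energy theorem*, Comm. Math. Phys. 80 (1981) 381–402,
  §3. [Witten1981]
* T. Parker, C. H. Taubes, *On Witten's proof of the positive energy theorem*, Comm. Math. Phys.
  84 (1982) 223–238, §3, (3.1)–(3.2) and the remark following. [ParkerTaubes1982]
-/

noncomputable section

open Bundle Set Function Manifold Finset Filter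
open scoped Manifold ContDiff Topology RealInnerProductSpace

namespace Literature.Geometry.Lorentzian

namespace SenWitten

open PauliModel

variable {X : Type*} [TopologicalSpace X] [ChartedSpace E3 X] [IsManifold (𝓡 3) ∞ X]
  (D : InitialDataSet (𝓡 3) X) (F : Fin 3 → Π x : X, TangentSpace (𝓡 3) x)

/-! ### The dominant energy condition makes the potential non-negative -/

section DEC

variable [D.metric.HasLeviCivita]

/-- **The current is dominated by the density**: `Σⱼ ⟪ψ, σⱼψ⟫² ≤ ‖ψ‖⁴` (indeed with equality,
the Fierz identity; only `≤` is used). [folklore] -/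
theorem sum_inner_pauli_sq_le (u : Spinor) : ∑ j, ⟪u, pauli j u⟫ ^ 2 ≤ (‖u‖ ^ 2) ^ 2 := by
  set S : Fin 3 → ℝ := fun j ↦ ⟪u, pauli j u⟫ with hS
  have hsum : ∑ j, S j ^ 2 = ⟪u, ∑ j, S j • pauli j u⟫ := by
    simp only [inner_sum, inner_smul_right, hS, sq]
  have hCS : ⟪u, ∑ j, S j • pauli j u⟫ ≤ ‖u‖ * ‖∑ j, S j • pauli j u‖ := real_inner_le_norm _ _
  have hs0 : 0 ≤ ∑ j, S j ^ 2 := Finset.sum_nonneg fun j _ ↦ sq_nonneg (S j)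
  have hnorm : ‖∑ j, S j • pauli j u‖ = Real.sqrt (∑ j, S j ^ 2) * ‖u‖ := by
    have h := norm_sq_sum_smul_pauli S u
    have h1 : ‖∑ j, S j • pauli j u‖ = Real.sqrt (‖∑ j, S j • pauli j u‖ ^ 2) :=
      (Real.sqrt_sq (norm_nonneg _)).symm
    rw [h1, h, Real.sqrt_mul hs0, Real.sqrt_sq (norm_nonneg _)]
  have hT : ∑ j, S j ^ 2 ≤ ‖u‖ ^ 2 * Real.sqrt (∑ j, S j ^ 2) := by
    calc ∑ j, S j ^ 2 = ⟪u, ∑ j, S j • pauli j u⟫ := hsum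
      _ ≤ ‖u‖ * ‖∑ j, S j • pauli j u‖ := hCS
      _ = ‖u‖ ^ 2 * Real.sqrt (∑ j, S j ^ 2) := by rw [hnorm]; ring
  have hsqrt : Real.sqrt (∑ j, S j ^ 2) ≤ ‖u‖ ^ 2 := by
    by_cases h0 : Real.sqrt (∑ j, S j ^ 2) = 0
    · rw [h0]; positivity
    · have hpos : 0 < Real.sqrt (∑ j, S j ^ 2) :=
        lt_of_le_of_ne (Real.sqrt_nonneg _) (Ne.symm h0)
      have h2 : Real.sqrt (∑ j, S j ^ 2) * Real.sqrt (∑ j, S j ^ 2) ≤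
          ‖u‖ ^ 2 * Real.sqrt (∑ j, S j ^ 2) := by
        rw [Real.mul_self_sqrt hs0]; exact hT
      exact le_of_mul_le_mul_right h2 hpos
  calc ∑ j, S j ^ 2 = Real.sqrt (∑ j, S j ^ 2) ^ 2 := (Real.sq_sqrt hs0).symm
    _ ≤ (‖u‖ ^ 2) ^ 2 := pow_le_pow_left₀ (Real.sqrt_nonneg _) hsqrt 2

omit [D.metric.HasLeviCivita] in
/-- **`h`-length of the current**: `h(Y_ψ, Y_ψ) = Σⱼ ⟪ψ, σⱼψ⟫² ≤ ‖ψ‖⁴` in an orthonormal frame.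
[folklore] -/
theorem inner_current_self_le {x : X}
    (horth : ∀ i j, D.h.inner x (F i x) (F j x) = if i = j then 1 else 0) (ψ : X → Spinor) :
    D.h.inner x (current F ψ x) (current F ψ x) ≤ (‖ψ x‖ ^ 2) ^ 2 := by
  rw [current_apply, PauliModel.inner_frameSum D horth]
  have h := sum_inner_pauli_sq_le (ψ x)
  simpa only [sq] using h

omit [D.metric.HasLeviCivita] in
/-- **Cauchy–Schwarz for a covector against the current**:
`α(Y_ψ)² ≤ h⁻¹(α, α) ‖ψ‖⁴` (`α(Y) = h(♯α, Y)`, Cauchy–Schwarz for `h_x`, `h(Y, Y) ≤ ‖ψ‖⁴`).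
[folklore] -/
theorem apply_current_sq_le {x : X}
    (horth : ∀ i j, D.h.inner x (F i x) (F j x) = if i = j then 1 else 0)
    (α : Module.Dual ℝ (TangentSpace (𝓡 3) x)) (ψ : X → Spinor) :
    α (current F ψ x) ^ 2 ≤ D.metric.innerDual x α α * (‖ψ x‖ ^ 2) ^ 2 := by
  have hR := D.isRiemannian_metric
  -- Cauchy–Schwarz for the positive definite form `h_x`
  have hCS : ∀ a b : TangentSpace (𝓡 3) x,
      D.metric.val x a b ^ 2 ≤ D.metric.val x a a * D.metric.val x b b := by
    intro a b
    have hpos : ∀ v : TangentSpace (𝓡 3) x, 0 ≤ D.metric.val x v v := fun v ↦ by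
      by_cases hv : v = 0
      · rw [hv]; simp
      · exact (hR x v hv).le
    have hquad : ∀ r : ℝ, 0 ≤ D.metric.val x b b * (r * r) + (-(2 * D.metric.val x a b)) * r +
        D.metric.val x a a := by
      intro r
      have h := hpos (a - r • b)
      have hexp : D.metric.val x (a - r • b) (a - r • b) =
          D.metric.val x b b * (r * r) + (-(2 * D.metric.val x a b)) * r + D.metric.val x a a := by
        simp only [map_sub, map_smul, FunLike.coe_sub, Pi.sub_apply,
          FunLike.coe_smul, Pi.smul_apply, smul_eq_mul, D.metric.symm x b a]
        ring
      rwa [hexp] at h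
    have hd := discrim_le_zero hquad
    rw [discrim] at hd
    nlinarith [hd]
  have h1 : α (current F ψ x) = D.metric.val x (D.metric.sharp x α) (current F ψ x) :=
    (D.metric.val_sharp_apply x α _).symm
  have h2 : D.metric.innerDual x α α = D.metric.val x (D.metric.sharp x α) (D.metric.sharp x α) :=
    D.metric.innerDual_eq_val_sharp_sharp x α α
  have h3 : D.metric.val x (current F ψ x) (current F ψ x) ≤ (‖ψ x‖ ^ 2) ^ 2 := by
    rw [D.val_metric]; exact inner_current_self_le D F horth ψ
  have h4 : 0 ≤ D.metric.val x (D.metric.sharp x α) (D.metric.sharp x α) := by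
    by_cases hv : D.metric.sharp x α = 0
    · rw [hv]; simp
    · exact (hR x _ hv).le
  rw [h1, h2]
  exact (hCS _ _).trans (mul_le_mul_of_nonneg_left h3 h4)

/-- **The dominant energy condition makes Witten's potential non-negative**: if `|J|_h ≤ μ`
then `decDensity ψ = 4π (μ ‖ψ‖² + J(Y_ψ)) ≥ 4π (μ − |J|_h) ‖ψ‖² ≥ 0` in any orthonormal frame
(`|J(Y_ψ)| ≤ |J|_h ‖ψ‖²`). Witten 1981, §3 (after (34)); Parker–Taubes 1982, remark after (3.2)
("the dominant energy condition implies `ℛ ≥ 0`"). [cite: ParkerTaubes1982, §3, remark after (3.2)] -/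
theorem decDensity_nonneg
    (horth : ∀ x i j, D.h.inner x (F i x) (F j x) = if i = j then 1 else 0)
    (hdec : D.SatisfiesDominantEnergyCondition) (ψ : X → Spinor) (x : X) :
    0 ≤ decDensity D F ψ x := by
  set μ := D.energyDensity x with hμ
  set J := D.momentumDensity x with hJ
  have hH : D.hamiltonianConstraintFn x = 16 * Real.pi * μ := by
    rw [hμ, InitialDataSet.energyDensity]
    field_simp
  have hM : ∀ v, D.momentumConstraintFn x v = 8 * Real.pi * J v := by
    intro v
    rw [hJ, InitialDataSet.momentumDensity, LinearMap.smul_apply, smul_eq_mul]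
    field_simp
  have hdecx := hdec x
  rw [← hJ, ← hμ] at hdecx
  -- `|J(Y)| ≤ μ ‖ψ‖²`
  have hJY : |J (current F ψ x)| ≤ μ * ‖ψ x‖ ^ 2 := by
    have hsq := apply_current_sq_le D F (horth x) J ψ
    have hnn : 0 ≤ D.metric.innerDual x J J := by
      rw [D.metric.innerDual_eq_val_sharp_sharp]
      by_cases hv : D.metric.sharp x J = 0
      · rw [hv]; simp
      · exact (D.isRiemannian_metric x _ hv).le
    have h1 : |J (current F ψ x)| ≤ Real.sqrt (D.metric.innerDual x J J) * ‖ψ x‖ ^ 2 := by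
      rw [← Real.sqrt_sq (abs_nonneg _), ← Real.sqrt_sq (by positivity : (0:ℝ) ≤ ‖ψ x‖ ^ 2),
        ← Real.sqrt_mul hnn]
      exact Real.sqrt_le_sqrt (by rw [sq_abs]; exact hsq)
    exact h1.trans (mul_le_mul_of_nonneg_right hdecx (by positivity))
  rw [decDensity_apply, hH, hM]
  have habs := neg_abs_le (J (current F ψ x))
  nlinarith [Real.pi_pos, hJY, habs, sq_nonneg ‖ψ x‖]

end DEC

end SenWitten

end Literature.Geometry.Lorentzian

end
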